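import Summits.Ventures.PercRepro.Night2NearFatFifteenTools
import Summits.Ventures.PercRepro.Night2NearFatSixteenAll

/-!
# night-2: h21's CELL `(2, 1)` AT `|G| = 15` WITH NO EIGHT-POINT LINE (gen 40)

A basis pair whose basis line carries five points of `W` (`|W| = 9`): its other long basis line has `≤ 4` points, its
classes `≤ 6`, the faces at the line's basis points `≤ 4` points, no load above level four is a distance-2 load
(Night2NearFatFifteenTools) — the per-face family closes it (`basis_pair_fair_nine_seven_line`).  With every line of `V` of
`≤ 7` or `≥ 9` points a lossy basis pair has a five-point basis line or all basis lines `≤ 4` and classes `≤ 6`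
(`basis_pair_fair_top_nine`): **`localShadowHall_fifteen_of_no_eight_line`**.  Paper: proofs/NIGHT-2-g40.md §10.
-/

namespace PercRepro.Shadow

open PercRepro.ThmH PercRepro.PerFlat

variable {α : Type*} [DecidableEq α] {M : Matroid α} [M.Finite] {G : Finset α}

/-- **A lossy basis pair with a five-point basis line at `|W| = 9` is fair.** -/
theorem basis_pair_fair_nine_seven_line (hG : G ∈ flatsQ M (5 + 1)) (hd : (gr M \ G).card = 2)
    (hk : kColoops M G = 1) (hs : ∀ e ∈ gr M, ∀ f ∈ gr M, e ≠ f → rkN M {e, f} = 2)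
    (hl : ∀ e ∈ gr M, M.Indep {e}) (hnf : fatClosures M 5 G 2 = ∅)
    {B : Finset α} (hB : B ∈ thinMembers M 5 G) (hnP : ¬ bigP M G B) {z : α} (hz : z ∈ G \ clF M B)
    (hl0 : loss M 5 G B z ≠ 0) (hW : (G \ insert z B).card = 9) {a b : α}
    (ha : a ∈ insert z B \ coloops M G) (hb : b ∈ insert z B \ coloops M G) (hab : a ≠ b)
    (h7 : ((G \ insert z B) ∩ clF M {a, b}).card = 5) :
    loss M 5 G B z ≤ rhoL M 5 G B z * lossIncomeH M 5 G (bigP M G) (dshGT2 M 5 G) B z := by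
  obtain ⟨ℓ₁, ℓ₂, C₁, C₂, hℓ₁, hℓ₂, hB2, hB1, ho₁, ho₂, hℓℓ, hc₁, hc₂, hcc, hℓc⟩ :=
    ntp_structure hG hd hk hs hl hB hnP hz (s := 5) (by norm_num) (by omega) (by omega)
  have hGg : G ⊆ gr M := (mem_flatsQ.1 hG).1
  have hQG : insert z B ⊆ G := Finset.insert_subset (Finset.mem_sdiff.1 hz).1 (subset_G_of_mem_thinMembers hB)
  have hQ'g : insert z B \ coloops M G ⊆ gr M := Finset.sdiff_subset.trans (hQG.trans hGg)
  have hind : M.Indep ((insert z B \ coloops M G : Finset α) : Set α) :=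
    (indep_insert_of_basis_pair hG hd hk hB hnP hz).subset (by exact_mod_cast (Finset.sdiff_subset))
  have hWg : G \ insert z B ⊆ gr M := Finset.sdiff_subset.trans hGg
  obtain ⟨L, hLdef⟩ : ∃ L : Finset α, L = (G \ insert z B) ∩ clF M {a, b} := ⟨_, rfl⟩
  have hL7 : L.card = 5 := by rw [hLdef]; exact h7
  have hLW : L ⊆ G \ insert z B := by rw [hLdef]; exact Finset.inter_subset_left
  have hLne : L.Nonempty := by
    rw [← Finset.card_pos, hL7]
    norm_num
  -- a basis line's `W`-part meeting `L` is `L`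
  have hLeq : ∀ a' ∈ insert z B \ coloops M G, ∀ b' ∈ insert z B \ coloops M G, a' ≠ b' →
      ∀ w ∈ (G \ insert z B) ∩ clF M {a', b'}, w ∈ L → (G \ insert z B) ∩ clF M {a', b'} = L := by
    intro a' ha' b' hb' hab' w hw hwL
    rw [hLdef] at hwL ⊢
    have hwQ : w ∉ insert z B \ coloops M G := fun h =>
      (Finset.mem_sdiff.1 (Finset.mem_inter.1 hw).1).2 (Finset.mem_sdiff.1 h).1
    rw [clF_pair_eq_of_mem_of_mem hs hl hQ'g hind ha' hb' ha hb hab' hab (hWg (Finset.mem_inter.1 hw).1) hwQ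
      (Finset.mem_inter.1 hw).2 (Finset.mem_inter.1 hwL).2]
  -- `L` is `ℓ₁` or `ℓ₂`
  have hLcov : L = ℓ₁ ∨ L = ℓ₂ := by
    have hB2' := hB2 a ha b hb hab
    rw [← hLdef] at hB2'
    obtain ⟨w, hw⟩ := hLne
    rcases hB2' with h | h | h
    · left
      rcases ho₁ with rfl | ⟨-, a', ha', b', hb', hab', rfl⟩
      · exfalso
        exact Finset.notMem_empty w (h hw)
      · exact (hLeq a' ha' b' hb' hab' w (h hw) hw).symm
    · right
      rcases ho₂ with rfl | ⟨-, a', ha', b', hb', hab', rfl⟩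
      · exfalso
        exact Finset.notMem_empty w (h hw)
      · exact (hLeq a' ha' b' hb' hab' w (h hw) hw).symm
    · exfalso
      omega
  -- a long basis line disjoint from `L` has exactly four points (`5 + 4 ≤ 9 < 5 + 5`)
  have hother : ∀ ℓ' : Finset α, ℓ' ⊆ G \ insert z B →
      (ℓ' = ∅ ∨ (4 ≤ ℓ'.card ∧ ∃ a' ∈ insert z B \ coloops M G, ∃ b' ∈ insert z B \ coloops M G, a' ≠ b' ∧
        ℓ' = (G \ insert z B) ∩ clF M {a', b'})) → (L ∩ ℓ').card = 0 → ℓ'.card = 0 ∨ ℓ'.card = 4 := by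
    intro ℓ' hℓ'W ho hint
    rcases ho with rfl | ⟨h5, -⟩
    · exact Or.inl Finset.card_empty
    · right
      have hA := Finset.card_union_add_card_inter L ℓ'
      have hU := Finset.card_le_card (Finset.union_subset hLW hℓ'W)
      omega
  -- the classes: a long class shares `≤ 1` point with `L` or is `L`: `≤ 5` points
  have hclass : ∀ C : Finset α, (C = C₁ ∨ C = C₂) →
      (C = ∅ ∨ (5 ≤ C.card ∧ ∃ a' ∈ insert z B \ coloops M G, ∃ y ∈ G \ insert z B,
        C = (G \ insert z B) ∩ clF M {a', y})) → C ⊆ G \ insert z B → C.card ≤ 6 := by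
    intro C hC ho hCW
    rcases ho with rfl | ⟨h6, -⟩
    · rw [Finset.card_empty]; norm_num
    · rcases hℓc L C hLcov hC with heq | hint
      · rw [← heq, hL7]; norm_num
      · have hA := Finset.card_union_add_card_inter L C
        have hU := Finset.card_le_card (Finset.union_subset hLW hCW)
        omega
  have hCW₁ : C₁ ⊆ G \ insert z B := by
    rcases hc₁ with rfl | ⟨-, a', -, y, -, rfl⟩
    · exact Finset.empty_subset _
    · exact Finset.inter_subset_left
  have hCW₂ : C₂ ⊆ G \ insert z B := by
    rcases hc₂ with rfl | ⟨-, a', -, y, -, rfl⟩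
    · exact Finset.empty_subset _
    · exact Finset.inter_subset_left
  have hC₁ := hclass C₁ (Or.inl rfl) hc₁ hCW₁
  have hC₂ := hclass C₂ (Or.inr rfl) hc₂ hCW₂
  -- the per-face bounds at `a` and `b`
  have hfa : ((G \ insert z B) ∩ clF M ((insert z B).erase a)).card ≤ 4 := by
    have := card_inter_face_le_of_line hG hd hk hs hB hnP hz ha hb hab
    omega
  have hfb : ((G \ insert z B) ∩ clF M ((insert z B).erase b)).card ≤ 4 := by
    have := card_inter_face_le_of_line hG hd hk hs hB hnP hz hb ha (Ne.symm hab)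
    have hpair : clF M {b, a} = clF M {a, b} := by rw [Finset.pair_comm]
    rw [hpair] at this
    omega
  -- no nine-missing line next to the seven-point line
  have hV15 : (G \ coloops M G).card = 14 := by
    rw [card_sdiff_coloops_eq_sub_one hk]
    have := card_sdiff_insert_eq_card_sub_six hG hd hk hB hnP hz
    have hQ6 : 6 ≤ G.card := by
      have h5 := (rkN_insert_sdiff_coloops_eq_five hG hd hk hB hnP hz).2
      have hKQ : coloops M G ⊆ insert z B :=
        fun x hx => Finset.mem_insert_of_mem (coloops_subset_of_mem_thinMembers hG (by omega) hB hx)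
      have := Finset.card_sdiff_of_subset hKQ
      have := Finset.card_le_card hQG
      omega
    omega
  have haV : a ∈ G \ coloops M G := Finset.mem_sdiff.2 ⟨hQG (Finset.mem_sdiff.1 ha).1, (Finset.mem_sdiff.1 ha).2⟩
  have hbV : b ∈ G \ coloops M G := Finset.mem_sdiff.2 ⟨hQG (Finset.mem_sdiff.1 hb).1, (Finset.mem_sdiff.1 hb).2⟩
  have h9 : 7 ≤ ((G \ coloops M G) ∩ clF M {a, b}).card := by
    have := card_inter_W_add_two_le hG hd hB hz ha hb hab
    omega
  have hnosix := no_nine_line_of_long_line hG hd hk hs hl hnf (by omega) haV hbV hab h9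
  have hdl : ∀ Y ⊆ G \ insert z B, 5 ≤ Y.card →
      ¬ ((∃ a ∈ insert z B \ coloops M G, ∃ b ∈ insert z B \ coloops M G, a ≠ b ∧
          Y.card ≤ (Y ∩ clF M {a, b}).card + 1) ∨
        ∃ a ∈ insert z B \ coloops M G, ∃ y ∈ Y, Y ⊆ clF M {a, y}) →
      dload M 5 G (bigP M G) (dshGT2 M 5 G) (insert z B ∪ Y) = 0 := by
    intro Y hYW hYs hnS
    apply dload_eq_zero_of_shape_of_no_six hG hd hk hs hl hnf hnosix hB hnP hz hYW (by omega)
    · intro a' ha' b' hb' hab'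
      by_contra hlt
      exact hnS (Or.inl ⟨a', ha', b', hb', hab', by omega⟩)
    · intro a' ha' y hy hsub
      exact hnS (Or.inr ⟨a', ha', y, hy, hsub⟩)
  have hC₁' : C₁.card ≤ 6 := hC₁
  have hC₂' : C₂.card ≤ 6 := hC₂
  -- the other basis line `ℓ'` (`∅` or four points) and the final cells
  rcases hLcov with hL₁ | hL₂
  · rcases hℓℓ with heq | hint
    · -- `ℓ₂ = ℓ₁ = L`: use `(L, ∅)`
      have hB2' : ∀ a' ∈ insert z B \ coloops M G, ∀ b' ∈ insert z B \ coloops M G, a' ≠ b' →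
          (G \ insert z B) ∩ clF M {a', b'} ⊆ ℓ₁ ∨ (G \ insert z B) ∩ clF M {a', b'} ⊆ (∅ : Finset α) ∨
            ((G \ insert z B) ∩ clF M {a', b'}).card + 2 ≤ 5 := by
        intro a' ha' b' hb' hab'
        rcases hB2 a' ha' b' hb' hab' with h | h | h
        · exact Or.inl h
        · exact Or.inl (heq ▸ h)
        · exact Or.inr (Or.inr h)
      apply basis_pair_fair_of_ntpB hG hd hk hs hl hnf hB hnP hz hl0 (by norm_num : 1 ≤ 5) ha hb hab hfa hfb hdl hℓ₁
        (Finset.empty_subset _) hB2' hB1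
      rw [hW, ← hL₁, hL7, Finset.card_empty]
      exact le_trans one_le_ntpIncomeB_nine_five_zero (ntpIncomeB_anti_e hC₁' hC₂')
    · have h04 := hother ℓ₂ hℓ₂ ho₂ (by rw [hL₁]; exact hint)
      apply basis_pair_fair_of_ntpB hG hd hk hs hl hnf hB hnP hz hl0 (by norm_num : 1 ≤ 5) ha hb hab hfa hfb hdl hℓ₁ hℓ₂
        hB2 hB1
      rw [hW, ← hL₁, hL7]
      rcases h04 with h0 | h4
      · rw [h0]
        exact le_trans one_le_ntpIncomeB_nine_five_zero (ntpIncomeB_anti_e hC₁' hC₂')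
      · rw [h4]
        exact le_trans one_le_ntpIncomeB_nine_five_four (ntpIncomeB_anti_e hC₁' hC₂')
  · rcases hℓℓ with heq | hint
    · have hB2' : ∀ a' ∈ insert z B \ coloops M G, ∀ b' ∈ insert z B \ coloops M G, a' ≠ b' →
          (G \ insert z B) ∩ clF M {a', b'} ⊆ ℓ₂ ∨ (G \ insert z B) ∩ clF M {a', b'} ⊆ (∅ : Finset α) ∨
            ((G \ insert z B) ∩ clF M {a', b'}).card + 2 ≤ 5 := by
        intro a' ha' b' hb' hab'
        rcases hB2 a' ha' b' hb' hab' with h | h | h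
        · exact Or.inl (heq ▸ h)
        · exact Or.inl h
        · exact Or.inr (Or.inr h)
      apply basis_pair_fair_of_ntpB hG hd hk hs hl hnf hB hnP hz hl0 (by norm_num : 1 ≤ 5) ha hb hab hfa hfb hdl hℓ₂
        (Finset.empty_subset _) hB2' hB1
      rw [hW, ← hL₂, hL7, Finset.card_empty]
      exact le_trans one_le_ntpIncomeB_nine_five_zero (ntpIncomeB_anti_e hC₁' hC₂')
    · have h04 := hother ℓ₁ hℓ₁ ho₁ (by rw [hL₂, Finset.inter_comm]; exact hint)
      apply basis_pair_fair_of_ntpB hG hd hk hs hl hnf hB hnP hz hl0 (by norm_num : 1 ≤ 5) ha hb hab hfa hfb hdl hℓ₁ hℓ₂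
        hB2 hB1
      rw [hW, ← hL₂, hL7, ntpIncomeB_comm]
      rcases h04 with h0 | h4
      · rw [h0]
        exact le_trans one_le_ntpIncomeB_nine_five_zero (ntpIncomeB_anti_e hC₁' hC₂')
      · rw [h4]
        exact le_trans one_le_ntpIncomeB_nine_five_four (ntpIncomeB_anti_e hC₁' hC₂')


/-- **h21's cell `(2, 1)` at `|G| = 15` with no eight-point line**: no fat closure and every line of `V` with `≤ 7` or `≥ 9`
points ⇒ the local Hall inequality. -/
theorem localShadowHall_fifteen_of_no_eight_line (hG : G ∈ flatsQ M (5 + 1)) (hd : (gr M \ G).card = 2)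
    (hk : kColoops M G = 1) (hs : ∀ e ∈ gr M, ∀ f ∈ gr M, e ≠ f → rkN M {e, f} = 2)
    (hl : ∀ e ∈ gr M, M.Indep {e}) (hnf : fatClosures M 5 G 2 = ∅) (h15 : G.card = 15)
    (hline : ∀ u ∈ G \ coloops M G, ∀ v ∈ G \ coloops M G, u ≠ v →
      ((G \ coloops M G) ∩ clF M {u, v}).card ≤ 7 ∨ 9 ≤ ((G \ coloops M G) ∩ clF M {u, v}).card) :
    LocalShadowHall M 5 G := by
  by_cases hlong : ∃ u ∈ G \ coloops M G, ∃ v ∈ G \ coloops M G, u ≠ v ∧ 9 ≤ ((G \ coloops M G) ∩ clF M {u, v}).card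
  · obtain ⟨u, hu, v, hv, huv, h9⟩ := hlong
    apply localShadowHall_of_long_line hG hd hk hs hl hu hv huv
    rw [card_sdiff_coloops_eq_sub_one hk]
    omega
  · push Not at hlong
    have hline' : ∀ u ∈ G \ coloops M G, ∀ v ∈ G \ coloops M G, u ≠ v →
        ((G \ coloops M G) ∩ clF M {u, v}).card ≤ 7 := by
      intro u hu v hv huv
      have := hlong u hu v hv huv
      rcases hline u hu v hv huv with h | h
      · exact h
      · omega
    have hfat : (fatClosures M 5 G 2).card ≤ 1 := by
      rw [hnf, Finset.card_empty]
      exact zero_le_one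
    apply localShadowHall_of_gt2_of_basis_fair hG hd hk hs hl hfat
    intro B hB hnP z hz
    by_cases hl0 : loss M 5 G B z = 0
    · rw [hl0]
      have hd' : (gr M \ G).card ≤ 5 := by omega
      have h1 : 0 ≤ rhoL M 5 G B z := by
        unfold rhoL
        rw [hl0]
        simp
      have h2 : 0 ≤ lossIncomeH M 5 G (bigP M G) (dshGT2 M 5 G) B z :=
        lossIncomeH_nonneg hG hd' (column_side_gt2 hG hd hk hs hl hfat) B z
      positivity
    · have hQG : insert z B ⊆ G := Finset.insert_subset (Finset.mem_sdiff.1 hz).1 (subset_G_of_mem_thinMembers hB)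
      have hW := card_sdiff_insert_eq_card_sub_six hG hd hk hB hnP hz
      have hQ'V : ∀ a ∈ insert z B \ coloops M G, a ∈ G \ coloops M G := fun a ha =>
        Finset.mem_sdiff.2 ⟨hQG (Finset.mem_sdiff.1 ha).1, (Finset.mem_sdiff.1 ha).2⟩
      have hWV : ∀ y ∈ G \ insert z B, y ∈ G \ coloops M G := fun y hy =>
        Finset.mem_sdiff.2 ⟨(Finset.mem_sdiff.1 hy).1, fun hK => (Finset.mem_sdiff.1 hy).2
          (Finset.mem_insert_of_mem (coloops_subset_of_mem_thinMembers hG (by omega) hB hK))⟩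
      by_cases hfive : ∃ a ∈ insert z B \ coloops M G, ∃ b ∈ insert z B \ coloops M G, a ≠ b ∧
          ((G \ insert z B) ∩ clF M {a, b}).card = 5
      · obtain ⟨a, ha, b, hb, hab, h5⟩ := hfive
        exact basis_pair_fair_nine_seven_line hG hd hk hs hl hnf hB hnP hz hl0 (by omega) ha hb hab h5
      · push Not at hfive
        apply basis_pair_fair_top_nine hG hd hk hs hl hnf hB hnP hz hl0 (by omega)
        · intro a ha b hb hab
          have h1 := le_trans (card_inter_W_add_two_le hG hd hB hz ha hb hab) (hline' a (hQ'V a ha) b (hQ'V b hb) hab)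
          have h2 := hfive a ha b hb hab
          omega
        · intro a ha y hy
          have hay : a ≠ y := fun h => (Finset.mem_sdiff.1 hy).2 (h ▸ (Finset.mem_sdiff.1 ha).1)
          have := le_trans (card_inter_W_add_one_le hG hd hB hz ha hy) (hline' a (hQ'V a ha) y (hWV y hy) hay)
          omega

end PercRepro.Shadow
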